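import Summits.BirchSwinnertonDyer.Rank1Residual.Additive.GordTwistMinimalModel
import Literature.NumberTheory.EllipticCurves.NeronLocalHeightCompletion
import Mathlib.AlgebraicGeometry.EllipticCurve.DivisionPolynomial.Basic
import HarnessLib

/-!
# Route `TameQuarticManinParity`, LINE 21 — local lemma for L14a (stmt-BirchSwinnertonDyer-27956):
# the `3`-adic valuation of `Ψ₂²` at a rational root of `Ψ₃` on a rational Tate normal form of type III / III*

Cell `pub/bsd-wall`, seat `bsd-line-ttd-p1` g9 (helper file for `TameQuarticManinParityKernelUnramifiedIffKodairaThree`).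
BSD is NOT proved by this; Manin's conjecture is not proved by this.

On a `ℚ`-model with `v₃(a₁,a₂,a₃,a₄) ≥ 1, v₃(a₆) ≥ 2, v₃(Δ) = 3` (type III) a rational root `x` of
`Ψ₃ = 3x⁴ + b₂x³ + 3b₄x² + 3b₆x + b₈` is a `3`-adic unit and `Ψ₂²(x) = 4x³ + b₂x² + 2b₄x + b₆` is a unit; with
`v₃(a₁) ≥ 1, v₃(a₂) ≥ 2, v₃(a₃),v₃(a₄) ≥ 3, v₃(a₆) ≥ 5, v₃(Δ) = 9` (type III*) one has `v₃(x) = 1` and `v₃(Ψ₂²(x)) = 3`.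
Method: from `v₃(Δ)` exactly one gets `v₃(b₄)`, `v₃(b₈)` exactly; any other valuation of `x` leaves a single dominant
term of `Ψ₃(x)`. Elementary valuation arithmetic; theorems only, no definition, no named fact, no `sorry`.
References: [SilvermanATAEC1994] IV.9.4 Steps 4 and 9, Table 4.1; [SilvermanAEC2009] III Ex. 3.7 (`Ψ₃`).
-/

set_option autoImplicit false
-- D-0017: single-problem summit, so `Summit.BirchSwinnertonDyer.BirchSwinnertonDyer.…` repeats a namespace BY DESIGN.
set_option linter.dupNamespace false

noncomputable section

open scoped Classical

namespace Summit.BirchSwinnertonDyer.BirchSwinnertonDyer.Theorems.TameQuarticManinParity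

open WeierstrassCurve IsDedekindDomain Rat.HeightOneSpectrum Polynomial WithZero
  Literature.NumberTheory.EllipticCurves Summit.BirchSwinnertonDyer.Rank1Residual.Additive

/-! ## §1 `3`-adic valuation bookkeeping at the place `(3)` of `ℤ` -/

/-- `v₍₃₎(x) = exp(−ord₃ x)` for `x ≠ 0`. [folklore] -/
private theorem v_eq_exp {x : ℚ} (hx : x ≠ 0) :
    (placeOf 3).valuation ℚ x = exp (-padicValRat 3 x) := by
  rw [valuation_eq_exp_neg_padicValRat (placeOf 3) hx, natGenerator_placeOf_eq]

/-- `3`-adic valuation bookkeeping (`v_three`). [folklore] -/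
private theorem v_three : (placeOf 3).valuation ℚ (3 : ℚ) = exp (-1 : ℤ) := by
  rw [v_eq_exp three_ne_zero]
  have : padicValRat 3 (3 : ℚ) = 1 := by exact_mod_cast padicValRat.self (p := 3) (by norm_num)
  rw [this]

/-- `3`-adic valuation bookkeeping (`v_natCast_of_not_dvd`). [folklore] -/
private theorem v_natCast_of_not_dvd {n : ℕ} (hn : n ≠ 0) (h3 : ¬ 3 ∣ n) :
    (placeOf 3).valuation ℚ (n : ℚ) = exp (0 : ℤ) := by
  rw [v_eq_exp (by exact_mod_cast hn)]
  have : padicValRat 3 (n : ℚ) = 0 := by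
    rw [padicValRat.of_nat]
    exact_mod_cast padicValNat.eq_zero_of_not_dvd h3
  rw [this, neg_zero]

/-- `3`-adic valuation bookkeeping (`v_two`). [folklore] -/
private theorem v_two : (placeOf 3).valuation ℚ (2 : ℚ) = exp (0 : ℤ) := by
  exact_mod_cast v_natCast_of_not_dvd (n := 2) (by norm_num) (by norm_num)

/-- `3`-adic valuation bookkeeping (`v_four`). [folklore] -/
private theorem v_four : (placeOf 3).valuation ℚ (4 : ℚ) = exp (0 : ℤ) := by
  exact_mod_cast v_natCast_of_not_dvd (n := 4) (by norm_num) (by norm_num)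

/-- `3`-adic valuation bookkeeping (`v_eight`). [folklore] -/
private theorem v_eight : (placeOf 3).valuation ℚ (8 : ℚ) = exp (0 : ℤ) := by
  exact_mod_cast v_natCast_of_not_dvd (n := 8) (by norm_num) (by norm_num)

/-- `3`-adic valuation bookkeeping (`v_nine`). [folklore] -/
private theorem v_nine : (placeOf 3).valuation ℚ (9 : ℚ) = exp (-2 : ℤ) := by
  rw [show (9 : ℚ) = 3 * 3 by norm_num, map_mul, v_three, ← exp_add]; norm_num

/-- `3`-adic valuation bookkeeping (`v_twentyseven`). [folklore] -/
private theorem v_twentyseven : (placeOf 3).valuation ℚ (27 : ℚ) = exp (-3 : ℤ) := by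
  rw [show (27 : ℚ) = 3 * (3 * 3) by norm_num, map_mul, map_mul, v_three, ← exp_add, ← exp_add]
  norm_num

/-- products: `v(a) ≤ exp m`, `v(b) ≤ exp n`, `m + n ≤ k` ⟹ `v(ab) ≤ exp k`. [folklore] -/
private theorem v_mul_le {a b : ℚ} {m n k : ℤ} (ha : (placeOf 3).valuation ℚ a ≤ exp m)
    (hb : (placeOf 3).valuation ℚ b ≤ exp n) (h : m + n ≤ k) :
    (placeOf 3).valuation ℚ (a * b) ≤ exp k := by
  rw [map_mul]
  exact (mul_le_mul' ha hb).trans (by rw [← exp_add]; exact exp_le_exp.mpr h)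

/-- `3`-adic valuation bookkeeping (`v_mul_eq`). [folklore] -/
private theorem v_mul_eq {a b : ℚ} {m n k : ℤ} (ha : (placeOf 3).valuation ℚ a = exp m)
    (hb : (placeOf 3).valuation ℚ b = exp n) (h : m + n = k) :
    (placeOf 3).valuation ℚ (a * b) = exp k := by
  rw [map_mul, ha, hb, ← exp_add, h]

/-- `3`-adic valuation bookkeeping (`v_pow_le`). [folklore] -/
private theorem v_pow_le {a : ℚ} {m l : ℤ} (ha : (placeOf 3).valuation ℚ a ≤ exp m) (k : ℕ)
    (h : (k : ℤ) * m ≤ l) : (placeOf 3).valuation ℚ (a ^ k) ≤ exp l := by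
  rw [map_pow]
  refine (pow_le_pow_left₀ zero_le ha k).trans ?_
  rw [← exp_nsmul, exp_le_exp, nsmul_eq_mul]
  exact h

/-- `3`-adic valuation bookkeeping (`v_pow_eq`). [folklore] -/
private theorem v_pow_eq {a : ℚ} {m l : ℤ} (ha : (placeOf 3).valuation ℚ a = exp m) (k : ℕ)
    (h : (k : ℤ) * m = l) : (placeOf 3).valuation ℚ (a ^ k) = exp l := by
  rw [map_pow, ha, ← exp_nsmul, nsmul_eq_mul, h]

/-- `3`-adic valuation bookkeeping (`v_add_le`). [folklore] -/
private theorem v_add_le {a b : ℚ} {k : ℤ} (ha : (placeOf 3).valuation ℚ a ≤ exp k)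
    (hb : (placeOf 3).valuation ℚ b ≤ exp k) : (placeOf 3).valuation ℚ (a + b) ≤ exp k :=
  Valuation.map_add_le _ ha hb

/-- `3`-adic valuation bookkeeping (`v_sub_le`). [folklore] -/
private theorem v_sub_le {a b : ℚ} {k : ℤ} (ha : (placeOf 3).valuation ℚ a ≤ exp k)
    (hb : (placeOf 3).valuation ℚ b ≤ exp k) : (placeOf 3).valuation ℚ (a - b) ≤ exp k :=
  Valuation.map_sub_le _ ha hb

/-- `3`-adic valuation bookkeeping (`v_le_of_le`). [folklore] -/
private theorem v_le_of_le {a : ℚ} {k l : ℤ} (ha : (placeOf 3).valuation ℚ a ≤ exp k) (h : k ≤ l) :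
    (placeOf 3).valuation ℚ a ≤ exp l :=
  ha.trans (exp_le_exp.mpr h)

/-- the discreteness step: `v(a) < exp k ⟹ v(a) ≤ exp (k − 1)`. [folklore] -/
private theorem v_le_pred_of_lt {a : ℚ} {k : ℤ} (ha : (placeOf 3).valuation ℚ a < exp k) :
    (placeOf 3).valuation ℚ a ≤ exp (k - 1) := by
  by_cases h0 : a = 0
  · rw [h0, map_zero]; exact zero_le
  · rw [v_eq_exp h0] at ha ⊢
    rw [exp_lt_exp] at ha
    exact exp_le_exp.mpr (by omega)

/-- the dominant-term step: `v(a) = exp k`, `v(b) ≤ exp l`, `l < k` ⟹ `v(a + b) = exp k` and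
`v(b + a) = exp k`. [folklore] -/
private theorem v_add_eq_of_lt {a b : ℚ} {k l : ℤ} (ha : (placeOf 3).valuation ℚ a = exp k)
    (hb : (placeOf 3).valuation ℚ b ≤ exp l) (h : l < k) :
    (placeOf 3).valuation ℚ (a + b) = exp k := by
  rw [← ha]
  exact Valuation.map_add_eq_of_lt_left _ (by rw [ha]; exact lt_of_le_of_lt hb (exp_lt_exp.mpr h))

/-- `3`-adic valuation bookkeeping (`v_add_eq_of_lt'`). [folklore] -/
private theorem v_add_eq_of_lt' {a b : ℚ} {k l : ℤ} (ha : (placeOf 3).valuation ℚ a = exp k)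
    (hb : (placeOf 3).valuation ℚ b ≤ exp l) (h : l < k) :
    (placeOf 3).valuation ℚ (b + a) = exp k := by
  rw [add_comm]; exact v_add_eq_of_lt ha hb h

/-! ## §2 The local law on a rational Tate normal form -/

/-- **Type III: every rational root of `Ψ₃` is a `3`-adic unit and `Ψ₂²` at it is a unit.** On a `ℚ`-model with
`v₃(a₁), v₃(a₂), v₃(a₃), v₃(a₄) ≥ 1`, `v₃(a₆) ≥ 2`, `v₃(Δ) = 3` (rational Tate normal form of type III), every
rational root `x` of `Ψ₃` has `v₃(Ψ₂²(x)) = 0`. [cite: SilvermanATAEC1994, IV.9.4 Step 4 and Table 4.1] -/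
theorem valuation_Ψ₂Sq_eval_of_tateNormalForm_III (V : WeierstrassCurve ℚ)
    (h₁ : (placeOf 3).valuation ℚ V.a₁ ≤ exp (-1 : ℤ)) (h₂ : (placeOf 3).valuation ℚ V.a₂ ≤ exp (-1 : ℤ))
    (h₃ : (placeOf 3).valuation ℚ V.a₃ ≤ exp (-1 : ℤ)) (h₄ : (placeOf 3).valuation ℚ V.a₄ ≤ exp (-1 : ℤ))
    (h₆ : (placeOf 3).valuation ℚ V.a₆ ≤ exp (-2 : ℤ))
    (hΔ : (placeOf 3).valuation ℚ V.Δ = exp (-3 : ℤ))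
    {x : ℚ} (hx : V.Ψ₃.eval x = 0) :
    (placeOf 3).valuation ℚ (V.Ψ₂Sq.eval x) = exp (0 : ℤ) := by
  -- the `b`-invariants
  have hb₂ : (placeOf 3).valuation ℚ V.b₂ ≤ exp (-1 : ℤ) := by
    rw [WeierstrassCurve.b₂]
    exact v_add_le (v_pow_le h₁ 2 (by norm_num)) (v_mul_le v_four.le h₂ (by norm_num))
  have hb₄le : (placeOf 3).valuation ℚ V.b₄ ≤ exp (-1 : ℤ) := by
    rw [WeierstrassCurve.b₄]
    exact v_add_le (v_mul_le v_two.le h₄ (by norm_num)) (v_mul_le h₁ h₃ (by norm_num))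
  have hb₆ : (placeOf 3).valuation ℚ V.b₆ ≤ exp (-2 : ℤ) := by
    rw [WeierstrassCurve.b₆]
    exact v_add_le (v_pow_le h₃ 2 (by norm_num)) (v_mul_le v_four.le h₆ (by norm_num))
  have hb₈le : (placeOf 3).valuation ℚ V.b₈ ≤ exp (-2 : ℤ) := by
    rw [WeierstrassCurve.b₈]
    refine v_sub_le (v_add_le (v_sub_le (v_add_le ?_ ?_) ?_) ?_) ?_
    · exact v_mul_le (v_pow_le h₁ 2 le_rfl) h₆ (by norm_num)
    · exact v_mul_le (v_mul_le v_four.le h₂ le_rfl) h₆ (by norm_num)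
    · exact v_mul_le (v_mul_le h₁ h₃ le_rfl) h₄ (by norm_num)
    · exact v_mul_le h₂ (v_pow_le h₃ 2 le_rfl) (by norm_num)
    · exact v_pow_le h₄ 2 (by norm_num)
  -- `v(b₄) = 1` exactly, from `v(Δ) = 3`
  have hb₄ : (placeOf 3).valuation ℚ V.b₄ = exp (-1 : ℤ) := by
    by_contra hne
    have hb₄' : (placeOf 3).valuation ℚ V.b₄ ≤ exp (-2 : ℤ) := by
      have := v_le_pred_of_lt (lt_of_le_of_ne hb₄le hne)
      simpa using this
    have hΔle : (placeOf 3).valuation ℚ V.Δ ≤ exp (-4 : ℤ) := by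
      rw [WeierstrassCurve.Δ]
      refine v_add_le (v_sub_le (v_sub_le ?_ ?_) ?_) ?_
      · exact v_mul_le (by rw [Valuation.map_neg]; exact v_pow_le hb₂ 2 le_rfl) hb₈le (by norm_num)
      · exact v_mul_le v_eight.le (v_pow_le hb₄' 3 le_rfl) (by norm_num)
      · exact v_mul_le v_twentyseven.le (v_pow_le hb₆ 2 le_rfl) (by norm_num)
      · exact v_mul_le (v_mul_le (v_mul_le v_nine.le hb₂ le_rfl) hb₄' le_rfl) hb₆ (by norm_num)
    rw [hΔ, exp_le_exp] at hΔle
    norm_num at hΔle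
  -- `v(a₄) = 1`, `v(b₈) = 2`
  have ha₄ : (placeOf 3).valuation ℚ V.a₄ = exp (-1 : ℤ) := by
    have h2a : (placeOf 3).valuation ℚ (2 * V.a₄) = exp (-1 : ℤ) := by
      have : 2 * V.a₄ = V.b₄ + -(V.a₁ * V.a₃) := by rw [WeierstrassCurve.b₄]; ring
      rw [this]
      refine v_add_eq_of_lt hb₄ (l := -2) ?_ (by norm_num)
      rw [Valuation.map_neg]
      exact v_mul_le h₁ h₃ (by norm_num)
    rwa [map_mul, v_two, exp_zero, one_mul] at h2a
  have hb₈ : (placeOf 3).valuation ℚ V.b₈ = exp (-2 : ℤ) := by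
    have : V.b₈ = -(V.a₄ ^ 2) + (V.a₁ ^ 2 * V.a₆ + 4 * V.a₂ * V.a₆ - V.a₁ * V.a₃ * V.a₄ + V.a₂ * V.a₃ ^ 2) := by
      rw [WeierstrassCurve.b₈]; ring
    rw [this]
    have hsq : (placeOf 3).valuation ℚ (-(V.a₄ ^ 2)) = exp (-2 : ℤ) := by
      rw [Valuation.map_neg]; exact v_pow_eq ha₄ 2 (by norm_num)
    refine v_add_eq_of_lt hsq (l := -3) ?_ (by norm_num)
    refine v_add_le (v_sub_le (v_add_le ?_ ?_) ?_) ?_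
    · exact v_mul_le (v_pow_le h₁ 2 le_rfl) h₆ (by norm_num)
    · exact v_mul_le (v_mul_le v_four.le h₂ le_rfl) h₆ (by norm_num)
    · exact v_mul_le (v_mul_le h₁ h₃ le_rfl) h₄ (by norm_num)
    · exact v_mul_le h₂ (v_pow_le h₃ 2 le_rfl) (by norm_num)
  -- the root is a `3`-adic unit
  have hΨ : V.Ψ₃.eval x = 3 * x ^ 4 + V.b₂ * x ^ 3 + 3 * V.b₄ * x ^ 2 + 3 * V.b₆ * x + V.b₈ := by
    simp only [WeierstrassCurve.Ψ₃, eval_add, eval_mul, eval_pow, eval_C, eval_X, eval_ofNat]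
  have hx0 : x ≠ 0 := by
    rintro rfl
    rw [hΨ] at hx
    simp only [ne_eq, OfNat.ofNat_ne_zero, not_false_eq_true, zero_pow, mul_zero, add_zero,
      zero_add] at hx
    rw [hx, map_zero] at hb₈
    exact exp_ne_zero hb₈.symm
  obtain ⟨n, hn⟩ : ∃ n : ℤ, (placeOf 3).valuation ℚ x = exp n := ⟨_, v_eq_exp hx0⟩
  have hT1 : (placeOf 3).valuation ℚ (3 * x ^ 4) = exp (-1 + 4 * n) :=
    v_mul_eq v_three (v_pow_eq hn 4 rfl) (by ring)
  have hT2 : (placeOf 3).valuation ℚ (V.b₂ * x ^ 3) ≤ exp (-1 + 3 * n) :=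
    v_mul_le hb₂ (v_pow_eq hn 3 rfl).le (by ring_nf; rfl)
  have hT3 : (placeOf 3).valuation ℚ (3 * V.b₄ * x ^ 2) = exp (-2 + 2 * n) :=
    v_mul_eq (v_mul_eq v_three hb₄ rfl) (v_pow_eq hn 2 rfl) (by ring)
  have hT4 : (placeOf 3).valuation ℚ (3 * V.b₆ * x) ≤ exp (-3 + n) := by
    have := v_mul_le (v_mul_le v_three.le hb₆ (le_refl _)) hn.le (le_refl _)
    simpa only [pow_one] using (this : (placeOf 3).valuation ℚ (3 * V.b₆ * x) ≤ exp (-1 + -2 + n)).trans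
      (exp_le_exp.mpr (by omega))
  have hn0 : n = 0 := by
    rcases lt_trichotomy n 0 with hneg | h0 | hpos
    · -- `v(x) < 1`: the constant term `b₈` dominates
      exfalso
      have hrest : (placeOf 3).valuation ℚ (3 * x ^ 4 + V.b₂ * x ^ 3 + 3 * V.b₄ * x ^ 2 + 3 * V.b₆ * x) ≤
          exp (-4 : ℤ) := by
        refine v_add_le (v_add_le (v_add_le ?_ ?_) ?_) ?_
        · exact v_le_of_le hT1.le (by omega)
        · exact v_le_of_le hT2 (by omega)
        · exact v_le_of_le hT3.le (by omega)
        · exact v_le_of_le hT4 (by omega)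
      have hval := v_add_eq_of_lt' hb₈ hrest (by norm_num)
      rw [← hΨ, hx, map_zero] at hval
      exact exp_ne_zero hval.symm
    · exact h0
    · -- `v(x) > 1`: the leading term `3x⁴` dominates
      exfalso
      have hrest : (placeOf 3).valuation ℚ (V.b₂ * x ^ 3 + 3 * V.b₄ * x ^ 2 + 3 * V.b₆ * x + V.b₈) ≤
          exp (-1 + 3 * n) := by
        refine v_add_le (v_add_le (v_add_le ?_ ?_) ?_) ?_
        · exact hT2
        · exact v_le_of_le hT3.le (by omega)
        · exact v_le_of_le hT4 (by omega)
        · exact v_le_of_le hb₈.le (by omega)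
      have hval := v_add_eq_of_lt hT1 hrest (by omega)
      have hsum : 3 * x ^ 4 + (V.b₂ * x ^ 3 + 3 * V.b₄ * x ^ 2 + 3 * V.b₆ * x + V.b₈) = V.Ψ₃.eval x := by
        rw [hΨ]; ring
      rw [hsum, hx, map_zero] at hval
      exact exp_ne_zero hval.symm
  subst hn0
  -- `Ψ₂²(x) = 4x³ + b₂x² + 2b₄x + b₆` is a unit
  have hΨ₂ : V.Ψ₂Sq.eval x = 4 * x ^ 3 + (V.b₂ * x ^ 2 + 2 * V.b₄ * x + V.b₆) := by
    simp only [WeierstrassCurve.Ψ₂Sq, eval_add, eval_mul, eval_pow, eval_C, eval_X]; ring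
  rw [hΨ₂]
  refine v_add_eq_of_lt (v_mul_eq v_four (v_pow_eq hn 3 rfl) (by norm_num)) (l := -1) ?_ (by norm_num)
  refine v_add_le (v_add_le ?_ ?_) ?_
  · exact v_mul_le hb₂ (v_pow_eq hn 2 rfl).le (by norm_num)
  · have := v_mul_le (v_mul_le v_two.le hb₄.le (le_refl _)) hn.le (le_refl _)
    exact v_le_of_le this (by norm_num)
  · exact v_le_of_le hb₆ (by norm_num)

/-- **Type III\*: every rational root of `Ψ₃` has `v₃ = 1` and `v₃(Ψ₂²(x)) = 3`.** On a `ℚ`-model with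
`v₃(a₁) ≥ 1`, `v₃(a₂) ≥ 2`, `v₃(a₃), v₃(a₄) ≥ 3`, `v₃(a₆) ≥ 5`, `v₃(Δ) = 9` (rational Tate normal form of type
III*), every rational root `x` of `Ψ₃` has `v₃(Ψ₂²(x)) = 3`. [cite: SilvermanATAEC1994, IV.9.4 Step 9 and Table 4.1] -/
theorem valuation_Ψ₂Sq_eval_of_tateNormalForm_IIIstar (V : WeierstrassCurve ℚ)
    (h₁ : (placeOf 3).valuation ℚ V.a₁ ≤ exp (-1 : ℤ)) (h₂ : (placeOf 3).valuation ℚ V.a₂ ≤ exp (-2 : ℤ))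
    (h₃ : (placeOf 3).valuation ℚ V.a₃ ≤ exp (-3 : ℤ)) (h₄ : (placeOf 3).valuation ℚ V.a₄ ≤ exp (-3 : ℤ))
    (h₆ : (placeOf 3).valuation ℚ V.a₆ ≤ exp (-5 : ℤ))
    (hΔ : (placeOf 3).valuation ℚ V.Δ = exp (-9 : ℤ))
    {x : ℚ} (hx : V.Ψ₃.eval x = 0) :
    (placeOf 3).valuation ℚ (V.Ψ₂Sq.eval x) = exp (-3 : ℤ) := by
  have hb₂ : (placeOf 3).valuation ℚ V.b₂ ≤ exp (-2 : ℤ) := by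
    rw [WeierstrassCurve.b₂]
    exact v_add_le (v_pow_le h₁ 2 (by norm_num)) (v_mul_le v_four.le h₂ (by norm_num))
  have hb₄le : (placeOf 3).valuation ℚ V.b₄ ≤ exp (-3 : ℤ) := by
    rw [WeierstrassCurve.b₄]
    exact v_add_le (v_mul_le v_two.le h₄ (by norm_num)) (v_mul_le h₁ h₃ (by norm_num))
  have hb₆ : (placeOf 3).valuation ℚ V.b₆ ≤ exp (-5 : ℤ) := by
    rw [WeierstrassCurve.b₆]
    exact v_add_le (v_pow_le h₃ 2 (by norm_num)) (v_mul_le v_four.le h₆ (by norm_num))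
  have hb₈le : (placeOf 3).valuation ℚ V.b₈ ≤ exp (-6 : ℤ) := by
    rw [WeierstrassCurve.b₈]
    refine v_sub_le (v_add_le (v_sub_le (v_add_le ?_ ?_) ?_) ?_) ?_
    · exact v_mul_le (v_pow_le h₁ 2 le_rfl) h₆ (by norm_num)
    · exact v_mul_le (v_mul_le v_four.le h₂ le_rfl) h₆ (by norm_num)
    · exact v_mul_le (v_mul_le h₁ h₃ le_rfl) h₄ (by norm_num)
    · exact v_mul_le h₂ (v_pow_le h₃ 2 le_rfl) (by norm_num)
    · exact v_pow_le h₄ 2 (by norm_num)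
  have hb₄ : (placeOf 3).valuation ℚ V.b₄ = exp (-3 : ℤ) := by
    by_contra hne
    have hb₄' : (placeOf 3).valuation ℚ V.b₄ ≤ exp (-4 : ℤ) := by
      have := v_le_pred_of_lt (lt_of_le_of_ne hb₄le hne)
      simpa using this
    have hΔle : (placeOf 3).valuation ℚ V.Δ ≤ exp (-10 : ℤ) := by
      rw [WeierstrassCurve.Δ]
      refine v_add_le (v_sub_le (v_sub_le ?_ ?_) ?_) ?_
      · exact v_mul_le (by rw [Valuation.map_neg]; exact v_pow_le hb₂ 2 le_rfl) hb₈le (by norm_num)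
      · exact v_mul_le v_eight.le (v_pow_le hb₄' 3 le_rfl) (by norm_num)
      · exact v_mul_le v_twentyseven.le (v_pow_le hb₆ 2 le_rfl) (by norm_num)
      · exact v_mul_le (v_mul_le (v_mul_le v_nine.le hb₂ le_rfl) hb₄' le_rfl) hb₆ (by norm_num)
    rw [hΔ, exp_le_exp] at hΔle
    norm_num at hΔle
  have ha₄ : (placeOf 3).valuation ℚ V.a₄ = exp (-3 : ℤ) := by
    have h2a : (placeOf 3).valuation ℚ (2 * V.a₄) = exp (-3 : ℤ) := by
      have : 2 * V.a₄ = V.b₄ + -(V.a₁ * V.a₃) := by rw [WeierstrassCurve.b₄]; ring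
      rw [this]
      refine v_add_eq_of_lt hb₄ (l := -4) ?_ (by norm_num)
      rw [Valuation.map_neg]
      exact v_mul_le h₁ h₃ (by norm_num)
    rwa [map_mul, v_two, exp_zero, one_mul] at h2a
  have hb₈ : (placeOf 3).valuation ℚ V.b₈ = exp (-6 : ℤ) := by
    have : V.b₈ = -(V.a₄ ^ 2) + (V.a₁ ^ 2 * V.a₆ + 4 * V.a₂ * V.a₆ - V.a₁ * V.a₃ * V.a₄ + V.a₂ * V.a₃ ^ 2) := by
      rw [WeierstrassCurve.b₈]; ring
    rw [this]
    have hsq : (placeOf 3).valuation ℚ (-(V.a₄ ^ 2)) = exp (-6 : ℤ) := by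
      rw [Valuation.map_neg]; exact v_pow_eq ha₄ 2 (by norm_num)
    refine v_add_eq_of_lt hsq (l := -7) ?_ (by norm_num)
    refine v_add_le (v_sub_le (v_add_le ?_ ?_) ?_) ?_
    · exact v_mul_le (v_pow_le h₁ 2 le_rfl) h₆ (by norm_num)
    · exact v_mul_le (v_mul_le v_four.le h₂ le_rfl) h₆ (by norm_num)
    · exact v_mul_le (v_mul_le h₁ h₃ le_rfl) h₄ (by norm_num)
    · exact v_mul_le h₂ (v_pow_le h₃ 2 le_rfl) (by norm_num)
  have hΨ : V.Ψ₃.eval x = 3 * x ^ 4 + V.b₂ * x ^ 3 + 3 * V.b₄ * x ^ 2 + 3 * V.b₆ * x + V.b₈ := by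
    simp only [WeierstrassCurve.Ψ₃, eval_add, eval_mul, eval_pow, eval_C, eval_X, eval_ofNat]
  have hx0 : x ≠ 0 := by
    rintro rfl
    rw [hΨ] at hx
    simp only [ne_eq, OfNat.ofNat_ne_zero, not_false_eq_true, zero_pow, mul_zero, add_zero,
      zero_add] at hx
    rw [hx, map_zero] at hb₈
    exact exp_ne_zero hb₈.symm
  obtain ⟨n, hn⟩ : ∃ n : ℤ, (placeOf 3).valuation ℚ x = exp n := ⟨_, v_eq_exp hx0⟩
  have hT1 : (placeOf 3).valuation ℚ (3 * x ^ 4) = exp (-1 + 4 * n) :=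
    v_mul_eq v_three (v_pow_eq hn 4 rfl) (by ring)
  have hT2 : (placeOf 3).valuation ℚ (V.b₂ * x ^ 3) ≤ exp (-2 + 3 * n) :=
    v_mul_le hb₂ (v_pow_eq hn 3 rfl).le (by ring_nf; rfl)
  have hT3 : (placeOf 3).valuation ℚ (3 * V.b₄ * x ^ 2) = exp (-4 + 2 * n) :=
    v_mul_eq (v_mul_eq v_three hb₄ rfl) (v_pow_eq hn 2 rfl) (by ring)
  have hT4 : (placeOf 3).valuation ℚ (3 * V.b₆ * x) ≤ exp (-6 + n) := by
    have := v_mul_le (v_mul_le v_three.le hb₆ (le_refl _)) hn.le (le_refl _)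
    simpa only [pow_one] using (this : (placeOf 3).valuation ℚ (3 * V.b₆ * x) ≤ exp (-1 + -5 + n)).trans
      (exp_le_exp.mpr (by omega))
  have hn1 : n = -1 := by
    rcases lt_trichotomy n (-1) with hneg | h1 | hpos
    · exfalso
      have hrest : (placeOf 3).valuation ℚ (3 * x ^ 4 + V.b₂ * x ^ 3 + 3 * V.b₄ * x ^ 2 + 3 * V.b₆ * x) ≤
          exp (-8 : ℤ) := by
        refine v_add_le (v_add_le (v_add_le ?_ ?_) ?_) ?_
        · exact v_le_of_le hT1.le (by omega)
        · exact v_le_of_le hT2 (by omega)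
        · exact v_le_of_le hT3.le (by omega)
        · exact v_le_of_le hT4 (by omega)
      have hval := v_add_eq_of_lt' hb₈ hrest (by norm_num)
      rw [← hΨ, hx, map_zero] at hval
      exact exp_ne_zero hval.symm
    · exact h1
    · exfalso
      have hrest : (placeOf 3).valuation ℚ (V.b₂ * x ^ 3 + 3 * V.b₄ * x ^ 2 + 3 * V.b₆ * x + V.b₈) ≤
          exp (-2 + 3 * n) := by
        refine v_add_le (v_add_le (v_add_le ?_ ?_) ?_) ?_
        · exact hT2
        · exact v_le_of_le hT3.le (by omega)
        · exact v_le_of_le hT4 (by omega)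
        · exact v_le_of_le hb₈.le (by omega)
      have hval := v_add_eq_of_lt hT1 hrest (by omega)
      have hsum : 3 * x ^ 4 + (V.b₂ * x ^ 3 + 3 * V.b₄ * x ^ 2 + 3 * V.b₆ * x + V.b₈) = V.Ψ₃.eval x := by
        rw [hΨ]; ring
      rw [hsum, hx, map_zero] at hval
      exact exp_ne_zero hval.symm
  subst hn1
  have hΨ₂ : V.Ψ₂Sq.eval x = 4 * x ^ 3 + (V.b₂ * x ^ 2 + 2 * V.b₄ * x + V.b₆) := by
    simp only [WeierstrassCurve.Ψ₂Sq, eval_add, eval_mul, eval_pow, eval_C, eval_X]; ring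
  rw [hΨ₂]
  refine v_add_eq_of_lt (v_mul_eq v_four (v_pow_eq hn 3 rfl) (by norm_num)) (l := -4) ?_ (by norm_num)
  refine v_add_le (v_add_le ?_ ?_) ?_
  · exact v_mul_le hb₂ (v_pow_eq hn 2 rfl).le (by norm_num)
  · have := v_mul_le (v_mul_le v_two.le hb₄.le (le_refl _)) hn.le (le_refl _)
    exact v_le_of_le this (by norm_num)
  · exact v_le_of_le hb₆ (by norm_num)

end Summit.BirchSwinnertonDyer.BirchSwinnertonDyer.Theorems.TameQuarticManinParity
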